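import Literature.AlgebraicGeometry.Motives.WeilJacobianStepOneOpen
import Literature.AlgebraicGeometry.Motives.JacobianBasePoint
import HarnessLib

/-!
# Fibres of the Abel sum map `C^r → J` of an ABSTRACT Jacobian over the `ℓ = 1` locus are single `𝔖_r`-orbits
# (Milne, *Jacobian Varieties*, §5 Thm. 5.1 (a): `f^{(r)}` is injective on `{ℓ = 1}`; Lange 2023, Lemma 4.2.1)

Layer `Literature/AlgebraicGeometry/Motives`, namespace `Literature.AlgebraicGeometry.Motives.Jacobian`.
KERNEL ONLY: theorems; no definition, no named fact, no instance, no `sorry`.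

A-p03 (g13)'s ★ `Motives/WeilJacobianStepOneOpen` proves the statement on WEIL'S MODEL `Jac` (★
`WeilJacobian.exists_perm_of_prod_comp_fJ_eq_of_ell_eq_one`: if `ℓ(Σⱼ τⱼ) = 1` and `∏ⱼ f(τ′ⱼ) = ∏ⱼ f(τⱼ)` in `Jac(K)` then `τ′` is
a permutation of `τ`; `r` free).  Here it is TRANSPORTED to an arbitrary Jacobian `𝒥 : Jacobian C` in the sense of the universal
property (`Motives/Jacobian`) and an arbitrary base point `P`, along the homomorphism `u : 𝒥.J ⟶ Jac` through which Weil's map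
`f = f_J : C → Jac` factors (★ `Jacobian.descPointed`, Milne Prop. 6.1: `f^{R₀} ≫ u = f_J`) — this uses ONLY the universal property
of `𝒥` (no identification `Jac ≅ 𝒥.J`, no Abel theorem):

* `Jacobian.prod_comp_abelJacobi_eq_mul_pow` — change of base point on Abel sums: `∏ⱼ f^P(τⱼ) = (∏ⱼ f^R(τⱼ)) · (f^R(P)⁻¹)ʳ`
  (★ `abelJacobi_eq_mul_const`);
* `Jacobian.prod_comp_abelJacobi_eq_iff` — hence `∏ⱼ f^P(τ′ⱼ) = ∏ⱼ f^P(τⱼ)` does not depend on `P`;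
* `WeilJacobian.baseTuple_comp_fJ` — `f_J(R₀(j₀)) = 0` (★ `clsX_comp_fJ`, `clsX_injective`);
* `Jacobian.prod_comp_fJ_eq_of_prod_comp_abelJacobi_eq` — `∏ⱼ f^P(τ′ⱼ) = ∏ⱼ f^P(τⱼ)` in `𝒥.J(K)` ⟹ `∏ⱼ f_J(τ′ⱼ) = ∏ⱼ f_J(τⱼ)` in
  `Jac(K)` (apply `u`; ★ `prod_comp_hom`);
* **`Jacobian.exists_perm_of_prod_comp_abelJacobi_eq_of_ell_eq_one_aux`** — the transport with Weil's auxiliary data explicit;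
* **`Jacobian.exists_perm_of_prod_comp_abelJacobi_eq_of_ell_eq_one`** — for a smooth projective curve of genus `≥ 1` over an
  algebraically closed field of characteristic `0`, EVERY Jacobian `𝒥`, every base point `P`, every `r` and tuples `τ, τ′ : Fin r → C(K)`
  with `ℓ(Σⱼ τⱼ) = 1`: `∏ⱼ f^P(τ′ⱼ) = ∏ⱼ f^P(τⱼ) ⟹ ∃ σ, τ′ = τ ∘ σ` (the auxiliary data discharged as in ★ `curveGenus_le_jacobian_dim`).

Cell `hodgecm-mathlib` (D-0151), crux HLiu418 = stmt-HodgeConjecture-24832, road G4 / (E) leaf (P0-inj-𝒥) = A-p02 (g15)'s `huniq` with `r`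
free on an abstract Jacobian (architect ruling 08:19:17Z).  COUNT-NEUTRAL capital; HC_CM is proved only modulo the 7 printed citations
until rung 0 closes.

## References
* [Milne1986JacobianVarieties] J. S. Milne, *Jacobian Varieties* (1986), §2 (change of base point `f^{P′} = t ∘ f^P`), §5 Thm. 5.1 (a)
  (the fibres of `f^{(r)}` are linear systems; injective on `ℓ = 1`), §6 Prop. 6.1 (universal property of `f^P`), §7 Thm. 7.1.
* [Lange2023AbelianVarietiesComplex] H. Lange, *Abelian Varieties over the Complex Numbers* (2023), §4.2.1 Lemma 4.2.1 (the fibres of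
  `α_{nc} : C^{(n)} → W̃_n`) and §4.1.3 (independence of the base point up to translation).
-/

set_option autoImplicit false

noncomputable section

universe u

open CategoryTheory CategoryTheory.Limits AlgebraicGeometry MonoidalCategory CartesianMonoidalCategory MonObj
open Literature.NumberTheory.DiophantineGeometry
open Literature.NumberTheory.DiophantineGeometry.AlgFunctionField
open Literature.AlgebraicGeometry.RelativeSpec

namespace Literature.AlgebraicGeometry.Motives

open RatFn FieldPoint CartierDivisor CurvePlaces

/-! ## §1 Abel sums and the base point (any field, any Jacobian) -/

namespace Jacobian

variable {k : Type u} [Field k] {C : SchemeOver k} (𝒥 : Jacobian C)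

/-- **Change of base point on Abel sums**: `∏ⱼ f^P(τⱼ) = (∏ⱼ f^R(τⱼ)) · (f^R(P)⁻¹)ʳ` — `f^P = f^R · [R − P]` (Milne §2, ★
`abelJacobi_eq_mul_const`). [cite: Milne1986JacobianVarieties, §2 (after the definition of f^P)] -/
theorem prod_comp_abelJacobi_eq_mul_pow (R P : AlgPoints C k) {r : ℕ} (τ : Fin r → AlgPoints C k) :
    (∏ j, τ j ≫ 𝒥.abelJacobi P) = (∏ j, τ j ≫ 𝒥.abelJacobi R) * ((P ≫ 𝒥.abelJacobi R)⁻¹) ^ r := by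
  have hpt : ∀ j, τ j ≫ 𝒥.abelJacobi P = (τ j ≫ 𝒥.abelJacobi R) * (P ≫ 𝒥.abelJacobi R)⁻¹ := fun j => by
    rw [𝒥.abelJacobi_eq_mul_const R P, MonObj.comp_mul, ← Category.assoc, point_comp_toSpecOver, Category.id_comp]
  simp_rw [hpt]
  rw [Finset.prod_mul_distrib, Finset.prod_const, Finset.card_univ, Fintype.card_fin]

/-- **`∏ⱼ f^P(τ′ⱼ) = ∏ⱼ f^P(τⱼ)` is independent of the base point `P`.** [cite: Milne1986JacobianVarieties, §2 (after the definition of f^P)] -/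
theorem prod_comp_abelJacobi_eq_iff (R P : AlgPoints C k) {r : ℕ} (τ τ' : Fin r → AlgPoints C k) :
    (∏ j, τ' j ≫ 𝒥.abelJacobi P) = (∏ j, τ j ≫ 𝒥.abelJacobi P) ↔
      (∏ j, τ' j ≫ 𝒥.abelJacobi R) = (∏ j, τ j ≫ 𝒥.abelJacobi R) := by
  rw [𝒥.prod_comp_abelJacobi_eq_mul_pow R P τ, 𝒥.prod_comp_abelJacobi_eq_mul_pow R P τ']
  exact ⟨fun h => mul_right_cancel h, fun h => by rw [h]⟩

end Jacobian

/-! ## §2 Transport to Weil's model along the Albanese factorisation `u : 𝒥.J → Jac` -/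

namespace WeilJacobian

variable {K : Type u} [Field K] [IsAlgClosed K] [CharZero K]
  (C : SchemeOver K) [IsIntegral C.left] [SmoothOfRelativeDimension 1 C.hom] [IsProper C.hom]
  [GeometricallyIntegral C.hom] (hC : IsProjectiveOver C) (hX : CechPseudoCoherentAt C) (g : ℕ)
  (hg : (genus K (curveBC C (strPt (K := K) K)).left.functionField : ℤ) ≤ g)
  (hW : (chartW C g hC).Nonempty) (j₀ : Fin g)

/-- `f_J(R₀(j₀)) = 0`: the base point of Weil's map `f_J : Q ↦ [Q − R₀(j₀)]` goes to the origin (its class is `[R₀(j₀) − R₀(j₀)] = 0`,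
★ `clsX_comp_fJ`, ★ `clsX_injective`). [cite: Milne1986JacobianVarieties, §7 (the map `C → J`)] -/
theorem baseTuple_comp_fJ : baseTuple C hC hX g hW j₀ ≫ fJ C hC hX g hg hW j₀ = 1 := by
  apply clsX_injective C hC hX g hg hW
  rw [clsX_comp_fJ, sub_self, clsX_one]
  rfl

end WeilJacobian

namespace Jacobian

variable {K : Type u} [Field K] [IsAlgClosed K] [CharZero K]
  {C : SchemeOver K} [IsIntegral C.left] [SmoothOfRelativeDimension 1 C.hom] [IsProper C.hom]
  [GeometricallyIntegral C.hom]

/-- **Equal Abel sums in an abstract Jacobian give equal Abel sums in Weil's**: if `∏ⱼ f^P(τ′ⱼ) = ∏ⱼ f^P(τⱼ)` in `𝒥.J(K)`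
then `∏ⱼ f_J(τ′ⱼ) = ∏ⱼ f_J(τⱼ)` in `Jac(K)` — move the base point to `R₀(j₀)` (§1) and apply the homomorphism `u : 𝒥.J → Jac` with
`f^{R₀(j₀)} ≫ u = f_J` (★ `descPointed` / `abelJacobi_descPointed`, Milne Prop. 6.1; ★ `prod_comp_hom`).
[cite: Milne1986JacobianVarieties, §6 Prop. 6.1 and §7 Thm. 7.1] -/
theorem prod_comp_fJ_eq_of_prod_comp_abelJacobi_eq
    (hC : IsProjectiveOver C) (hX : CechPseudoCoherentAt C) (g : ℕ)
    (hg : (genus K (curveBC C (strPt (K := K) K)).left.functionField : ℤ) ≤ g)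
    (hW : (chartW C g hC).Nonempty) (j₀ : Fin g) (𝒥 : Jacobian C) (P : AlgPoints C K) {r : ℕ} (τ τ' : Fin r → AlgPoints C K)
    (h : (∏ j, τ' j ≫ 𝒥.abelJacobi P) = (∏ j, τ j ≫ 𝒥.abelJacobi P)) :
    (∏ j, τ' j ≫ WeilJacobian.fJ C hC hX g hg hW j₀) = (∏ j, τ j ≫ WeilJacobian.fJ C hC hX g hg hW j₀) := by
  set R := WeilJacobian.baseTuple C hC hX g hW j₀ with hR
  have hfR : R ≫ WeilJacobian.fJ C hC hX g hg hW j₀ = 1 := WeilJacobian.baseTuple_comp_fJ C hC hX g hg hW j₀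
  have hu := 𝒥.abelJacobi_descPointed R _ hfR
  have h' := (𝒥.prod_comp_abelJacobi_eq_iff R P τ τ').mp h
  have h'' := congrArg (fun x => x ≫ (𝒥.descPointed R _ hfR).hom.hom.hom) h'
  simp only [prod_comp_hom, Category.assoc, hu] at h''
  exact h''

/-- **Fibres of the Abel sum over the `ℓ = 1` locus are single `𝔖_r`-orbits, for an ABSTRACT Jacobian** (Weil's auxiliary data
`hC hX g hg hW j₀` explicit): for `τ, τ′ : Fin r → C(K)` with `ℓ(Σⱼ τⱼ) = 1` and `∏ⱼ f^P(τ′ⱼ) = ∏ⱼ f^P(τⱼ)` in `𝒥.J(K)`, `τ′ = τ ∘ σ` for a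
permutation `σ` (transport + ★ `WeilJacobian.exists_perm_of_prod_comp_fJ_eq_of_ell_eq_one`). [cite: Milne1986JacobianVarieties, §5 Thm. 5.1 (a) and §6 Prop. 6.1]
[cite: Lange2023AbelianVarietiesComplex, §4.2.1 Lemma 4.2.1] -/
theorem exists_perm_of_prod_comp_abelJacobi_eq_of_ell_eq_one_aux
    (hC : IsProjectiveOver C) (hX : CechPseudoCoherentAt C) (g : ℕ)
    (hg : (genus K (curveBC C (strPt (K := K) K)).left.functionField : ℤ) ≤ g)
    (hW : (chartW C g hC).Nonempty) (j₀ : Fin g) (𝒥 : Jacobian C) (P : AlgPoints C K) {r : ℕ} (τ : Fin r → AlgPoints C K)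
    (hℓ : ell (tupleDiv C τ) = 1) (τ' : Fin r → AlgPoints C K)
    (h : (∏ j, τ' j ≫ 𝒥.abelJacobi P) = (∏ j, τ j ≫ 𝒥.abelJacobi P)) :
    ∃ σ : Equiv.Perm (Fin r), τ' = τ ∘ σ :=
  WeilJacobian.exists_perm_of_prod_comp_fJ_eq_of_ell_eq_one C hC hX g hg hW j₀ τ hℓ τ'
    (prod_comp_fJ_eq_of_prod_comp_abelJacobi_eq hC hX g hg hW j₀ 𝒥 P τ τ' h)

/-- **Milne Thm. 5.1 (a) / Lange Lemma 4.2.1 for an ABSTRACT Jacobian: fibres of `(τⱼ) ↦ ∏ⱼ f^P(τⱼ)` over the `ℓ = 1` locus are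
single `𝔖_r`-orbits.**  For a smooth projective curve `C` of genus `≥ 1` over an algebraically closed field of characteristic `0`,
ANY Jacobian `𝒥` of `C` (universal property of `Motives/Jacobian`), any base point `P ∈ C(K)`, any `r`, and tuples
`τ, τ′ : Fin r → C(K)` with `ℓ(Σⱼ τⱼ) = 1`: `∏ⱼ f^P(τ′ⱼ) = ∏ⱼ f^P(τⱼ)` in `J(K)` implies `τ′ = τ ∘ σ` for a permutation `σ` of `Fin r`.
Weil's auxiliary data are discharged as in ★ `curveGenus_le_jacobian_dim` (`2g − 1` distinct `K`-points make the chart `W` non-empty).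
[cite: Milne1986JacobianVarieties, §5 Thm. 5.1 (a), §6 Prop. 6.1 and §7 Thm. 7.1] [cite: Lange2023AbelianVarietiesComplex, §4.2.1 Lemma 4.2.1] -/
theorem exists_perm_of_prod_comp_abelJacobi_eq_of_ell_eq_one (hC : IsProjectiveOver C) (hpos : 1 ≤ curveGenus C)
    (𝒥 : Jacobian C) (P : AlgPoints C K) {r : ℕ} (τ : Fin r → AlgPoints C K)
    (hℓ : ell (tupleDiv C τ) = 1) (τ' : Fin r → AlgPoints C K)
    (h : (∏ j, τ' j ≫ 𝒥.abelJacobi P) = (∏ j, τ j ≫ 𝒥.abelJacobi P)) :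
    ∃ σ : Equiv.Perm (Fin r), τ' = τ ∘ σ := by
  obtain ⟨n, hn⟩ : ∃ n, curveGenus C = n + 1 := ⟨curveGenus C - 1, by omega⟩
  have hX : CechPseudoCoherentAt C := cechPseudoCoherentAt_of_general cechComplex_pseudoCoherent_general_holds C
  have hg : (genus K (curveBC C (strPt (K := K) K)).left.functionField : ℤ) ≤ curveGenus C := by
    exact_mod_cast (curveGenus_curveBC C (strPt (K := K) K)).le
  haveI := infinite_algPoints C
  let a := Infinite.natEmbedding (AlgPoints C K)
  let s : Fin (2 * curveGenus C) → (𝟙_ (SchemeOver K) ⟶ C) := fun j ↦ unitToSpecOver K ≫ a j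
  have hs : Function.Injective s := fun j₁ j₂ h ↦ by
    have h' := congrArg (toUnit (specOver K K) ≫ ·) h
    simp only [s] at h'
    rw [← Category.assoc, toUnit_unitToSpecOver, Category.id_comp, ← Category.assoc, toUnit_unitToSpecOver,
      Category.id_comp] at h'
    exact Fin.val_injective (a.injective h')
  have hW : (chartW C (curveGenus C) hC).Nonempty :=
    chartW_nonempty C (curveGenus C) hC (nonempty_generalLocus_of_sections C s hs (by omega))
  exact exists_perm_of_prod_comp_abelJacobi_eq_of_ell_eq_one_aux hC hX (curveGenus C) hg hW ⟨0, by omega⟩ 𝒥 P τ hℓ τ' h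

end Jacobian

end Literature.AlgebraicGeometry.Motives

end
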